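import Literature.Computability.AlgebraicComplexity.BLMW11KroneckerApproximation
import Literature.Computability.AlgebraicComplexity.BLMW11InvariantDimensionTransport
import Literature.Computability.AlgebraicComplexity.BI17ChowMonomialStabilizerProofs
import Literature.Computability.AlgebraicComplexity.BLMW11PerSliceCharacterProofs
import Literature.RepresentationTheory.FiniteGroups.SymmetricGroupIsotypic
import HarnessLib

/-!
# BLMW 2011, Cor. 8.4.2 (Gay): the `𝔖_n`-invariants of the zero weight space `(S_μℂⁿ)_0` —
# `BLMW2011_cor_8_4_2_holds` (proved)

Cell `val-lit` (D-0074 GROUP L), row BLMW11-B, discharge duty on the named fact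
`BLMW2011_cor_8_4_2` of `BLMW11KroneckerApproximation.lean` (P. Bürgisser, J. M. Landsberg,
L. Manivel, J. Weyman, *An overview of mathematical issues arising in the geometric complexity
theory approach to VP ≠ VNP*, SIAM J. Comput. 40(4) (2011) = arXiv:0907.2850v2, §8.4, Cor. 8.4.2
of Gay's Thm. 8.4.1): "Let `μ` be a partition of size `nδ`. The dimension of the space of
`𝔖_n`-invariants in the zero weight space `(S_μℂⁿ)_0` equals the multiplicity of `S_μℂⁿ` in the
plethysm `S^n(S^δℂⁿ)`." Theorems only (no definitions, no named facts). Honest framing: classical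
representation theory (Schur–Weyl / Gay); VP ≠ VNP is NOT proved and nothing here is progress on it.

## What is proved here

Write `V = ℂⁿ`, `D = nδ`, `H ≤ GL_n` for the stabilizer of the monomial `x₁ ⋯ x_n` — the monomial
matrices `P_π · diag(c)` with `∏ c_i = 1` (Bürgisser–Ikenmeyer 2017, Prop. 2.4 (1); tree:
`linStabilizer_prodX_eq_closure`, `exists_perm_diagonal_of_mem_linStabilizer_prodX`).

* §1 `zeroWeightInvariants_eq_subgroupInvariants`: the `𝔖_n`-invariants of the zero weight space
  `(S_μV)_0` (the tree's `zeroWeightInvariants ℂ μ δ`: vectors of `GL_n`-weight `(δ,…,δ)` fixed by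
  the permutation matrices) ARE the `H`-invariants `(S_μV)^H` — a vector fixed by the unimodular
  diagonal matrices is a zero-weight vector (an arbitrary diagonal `t` is `c · t'` with `cⁿ = det t`,
  `t'` unimodular, and the scalar `c` acts on `S_μV ⊂ V^{⊗D}` by `c^D = (det t)^δ`; Fulton–Harris
  §15.5), and conversely. This is BLMW's own rendering `(S_μE)_0^{𝔚_E}` of §5.5 (proof of
  Prop. 5.5.2: the invariants of `T_E ⋊ 𝔚_E`).
* §2 `invariants_wordRep_prodXStabilizer_eq_perSliceSpace`: in the word model of `V^{⊗D}`
  (`wordRep`, functions on words `w : Fin D → Fin n`) the `H`-fixed vectors are exactly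
  `perSliceSpace ℂ n D` of `BLMW11PerOrbitCeiling.lean` — functions supported on the words of
  constant content (`(V^{⊗D})^{T'}`, tested with `diag(…,2,…,½,…)`, characteristic zero) and
  invariant under relabelling the letters (`𝔚_E`).
* §3 `factorial_mul_finrank_zeroWeightInvariants`: hence, for `μ ⊢ nδ` with at most `n` parts,
  `D! · dim (S_μV)_0^{𝔖_n} = ∑_{τ ∈ 𝔖_D} χ^μ(τ) χ₀(τ)`, `χ₀` the character of `𝔖_D` on
  `perSliceSpace ℂ n D`: the tree's transport `dim (S_μV)^H = dim {μ}^H`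
  (`finrank_subgroupInvariants_schurRep_stdRep_eq_weylInvariantDim`), Ikenmeyer–Kandasamy's
  `dim {μ}^H = dim T_H` (`IK2020.finrank_boundSpace_invariants_eq_weylInvariantDim`, the bound space
  `([μ] ⊗ (V^{⊗D})^H)^{𝔖_D}`) and the count `D! · dim T = ∑_τ χ^μ(τ) χ_X(τ)`
  (`card_mul_finrank_boundSpace`, `character_transposedPermRep_dualOfPartition`). In other words
  `dim (S_μV)_0^{𝔖_n} = ⟨χ^μ, χ₀⟩_{𝔖_D}`, the multiplicity of `[μ]` in
  `perSliceSpace ≅ ℂ[𝔖_D / 𝔖_n ≀ 𝔖_δ] = Ind 1`, which is Gay's theorem in character form; the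
  identification of that multiplicity with the plethysm coefficient
  `plethysmCoeffOfPartition ℂ n δ μ` (`= dim` of the `𝔖_n ≀ 𝔖_δ`-invariant highest-weight vectors,
  `plethysmCoeffOfPartition_eq_finrank_wreathHW`) is the character identity
  `χ₀ = ∑_μ p_μ χ^μ` of the companion file `BLMW11PerSliceCharacterProofs.lean` (val-lit t08:
  `sum_spechtCharacter_mul_character_perSliceSpace`, `∑_τ χ^μ(τ) χ₀(τ) = (mδ)!·p_μ` for `δ > 0`,
  `ℓ(μ) ≤ m`), consumed by name in the final step §6.
* §4 row orthogonality `∑_τ χ^μ(τ)χ^ν(τ) = [μ = ν]·D!` (`sum_spechtCharacter_mul_spechtCharacter`, from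
  the tree's `IsIrrChar.classInner_eq` for the Specht characters) and the Fourier-coefficient form
  `sum_spechtCharacter_mul_eq_of_eq_sum`; the degenerate alphabet `n = 0` of Cor. 8.4.2
  (`finrank_zeroWeightInvariants_alphabet_zero`: both sides are `1`).
* §5 `BLMW2011_cor_8_4_2_of_characterIdentity`: Cor. 8.4.2 follows from the identity
  `∑_τ χ^μ(τ) χ₀(τ) = (nδ)!·p_μ` (`n, δ ≥ 1`, `ℓ(μ) ≤ n`), `p_μ = plethysmCoeffOfPartition ℂ n δ μ`.
* §6 **`BLMW2011_cor_8_4_2_holds : BLMW2011_cor_8_4_2`** — the discharge, §5 fed with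
  `sum_spechtCharacter_mul_character_perSliceSpace` of `BLMW11PerSliceCharacterProofs.lean`.

## References

* [BurgisserEtAl2011] BLMW 2011, §8.4 Thm. 8.4.1 (Gay), Cor. 8.4.2; §5.5 (proof of Prop. 5.5.2:
  `X_μ = (S_μE)_0^{𝔚_E}`, `p_μ = dim X_μ`).
* D. A. Gay, *Characters of the Weyl group of `SU(n)` on zero weight spaces and centralizers of
  permutation representations*, Rocky Mountain J. Math. 6 (1976) 449–455 (BLMW's [Gay]).
* [BurgisserIkenmeyer2017] P. Bürgisser, C. Ikenmeyer, J. Algebra 477 (2017), Prop. 2.4 (1) (the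
  stabilizer of `X_1⋯X_m`; tree `BI17ChowMonomialStabilizerProofs.lean`).
* [IkenmeyerKandasamy2019] C. Ikenmeyer, U. Kandasamy, arXiv:1911.03990, §9 (9.4) (`{λ}^H`).
* [FultonHarrisGTM129] W. Fulton, J. Harris, *Representation Theory*, §6.1 (Schur–Weyl), §15.3,
  §15.5.
-/

noncomputable section

open MvPolynomial
open scoped BigOperators Matrix

namespace Literature.Computability.AlgebraicComplexity

open _root_.Literature.NumberTheory.DiophantineGeometry
open _root_.Literature.RepresentationTheory.GeneralLinear
open _root_.Literature.RepresentationTheory.FiniteGroups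

/-! ### §2 (first, no Schur functors needed) The `H`-fixed words are `perSliceSpace` -/

section Words

variable {k : Type*} [Field k] {n D : ℕ}

/-- Entries of a permutation matrix: `P_π a b = [π a = b]`. [folklore] -/
private theorem permMatrix_apply'' (π : Equiv.Perm (Fin n)) (a b : Fin n) :
    π.permMatrix k a b = if π a = b then 1 else 0 := by
  rw [Equiv.Perm.permMatrix, PEquiv.toMatrix_toPEquiv_apply, Pi.single_apply]
  by_cases h : π a = b
  · rw [if_pos h, if_pos h.symm]
  · rw [if_neg h, if_neg (Ne.symm h)]

/-- **A permutation matrix acts on functions of words by relabelling the letters**: if the matrix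
of `γ ∈ GL_n` is `P_π` then `(γ · c)(w) = c (π ∘ w)` (`e_{π a}`-column bookkeeping in the word model
`wordRep`; BLMW §5.5 (5.5.1): the Weyl group `𝔚_E` of permutation matrices acting on `E^{⊗D}`).
[cite: BurgisserEtAl2011, §5.5 (5.5.1)] -/
theorem wordRep_apply_of_coe_eq_permMatrix {γ : GL (Fin n) k} {π : Equiv.Perm (Fin n)}
    (hγ : (γ : Matrix (Fin n) (Fin n) k) = π.permMatrix k) (c : Word n D → k) (w : Word n D) :
    wordRep k n D γ c w = c (⇑π ∘ w) := by
  rw [wordRep_apply, Finset.sum_eq_single (⇑π ∘ w)]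
  · rw [hγ, Finset.prod_eq_one (fun p _ => by
      rw [permMatrix_apply'', Function.comp_apply, if_pos rfl]), one_mul]
  · intro w' _ hw'
    obtain ⟨p, hp⟩ := Function.ne_iff.mp hw'
    rw [hγ, Finset.prod_eq_zero (Finset.mem_univ p), zero_mul]
    rw [permMatrix_apply'', if_neg]
    intro h
    exact hp (by rw [Function.comp_apply]; exact h.symm)
  · intro h
    exact absurd (Finset.mem_univ _) h

/-- **A diagonal matrix acts on functions of words diagonally**: if the matrix of `γ ∈ GL_n` is
`diag(d)` then `(γ · c)(w) = (∏_p d (w p)) · c(w)` (the word `w` is a weight vector of weight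
`content(w)`; Fulton–Harris §15.3, the weights of the basis tensors `e_w` of `V^{⊗D}`).
[cite: FultonHarrisGTM129, §15.3] -/
theorem wordRep_apply_of_coe_eq_diagonal {γ : GL (Fin n) k} {d : Fin n → k}
    (hγ : (γ : Matrix (Fin n) (Fin n) k) = Matrix.diagonal d) (c : Word n D → k) (w : Word n D) :
    wordRep k n D γ c w = (∏ p, d (w p)) * c w := by
  rw [wordRep_apply, Finset.sum_eq_single w]
  · rw [hγ]
    simp [Matrix.diagonal_apply_eq]
  · intro w' _ hw'
    obtain ⟨p, hp⟩ := Function.ne_iff.mp hw'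
    rw [Finset.prod_eq_zero (Finset.mem_univ p), zero_mul]
    rw [hγ, Matrix.diagonal_apply_ne _ (Ne.symm hp)]
  · intro h
    exact absurd (Finset.mem_univ w) h

/-- On a word all of whose letters occur equally often, a diagonal weight with `∏ d_i = 1` is
trivial: `∏_p d (w p) = ∏_i d_i ^ {content_i(w)} = (∏_i d_i)^{c} = 1`. [folklore] -/
private theorem prod_apply_eq_one_of_wordContent_const {d : Fin n → k} (hd : ∏ i, d i = 1) {w : Word n D}
    (hw : ∀ i j : Fin n, wordContent w i = wordContent w j) : ∏ p, d (w p) = 1 := by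
  rw [prod_eq_prod_pow_wordContent]
  rcases isEmpty_or_nonempty (Fin n) with hn | ⟨⟨i₀⟩⟩
  · simp
  · rw [Finset.prod_congr rfl fun i _ => by rw [hw i i₀], Finset.prod_pow, hd, one_pow]

variable [CharZero k]

/-- In characteristic zero `2^a (2⁻¹)^b = 1` forces `a = b`. [folklore] -/
private theorem eq_of_two_pow_mul_inv_two_pow_eq_one' {a b : ℕ}
    (h : (2 : k) ^ a * (2⁻¹ : k) ^ b = 1) : a = b := by
  have h2 : (2 : k) ≠ 0 := two_ne_zero
  have h' : (2 : k) ^ (a : ℤ) = (2 : k) ^ (b : ℤ) := by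
    rw [zpow_natCast, zpow_natCast]
    have hb : (2⁻¹ : k) ^ b * 2 ^ b = 1 := by rw [← mul_pow, inv_mul_cancel₀ h2, one_pow]
    calc (2 : k) ^ a = 2 ^ a * ((2⁻¹ : k) ^ b * 2 ^ b) := by rw [hb, mul_one]
      _ = (2 ^ a * (2⁻¹ : k) ^ b) * 2 ^ b := by ring
      _ = 2 ^ b := by rw [h, one_mul]
  exact_mod_cast two_zpow_injective k h'

/-- **The words fixed by the stabilizer of `x₁⋯x_n` are `perSliceSpace`** (`V = kⁿ`, characteristic
zero): a function on words of length `D` is fixed by every `γ ∈ H = stab(x₁⋯x_n)` — the monomial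
matrices with unimodular diagonal part (Bürgisser–Ikenmeyer 2017, Prop. 2.4 (1)) — iff it is
supported on the words of constant content and invariant under relabelling the letters, i.e. lies in
`perSliceSpace k n D` (`= ((E^{⊗D})_0)^{𝔚_E}` of BLMW §5.5). (⇒) test with the unimodular diagonal
`diag(…, 2, …, ½, …)` (weight `2^{content_i - content_j}`) and with the permutation matrices;
(⇐) the generators of `H` (`linStabilizer_prodX_eq_closure`) fix such a function.
[cite: BurgisserEtAl2011, §5.5 (proof of Prop. 5.5.2)] -/
theorem invariants_wordRep_prodXStabilizer_eq_perSliceSpace :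
    Representation.invariants ((wordRep k n D).comp
        (linStabilizer (∏ i : Fin n, (X i : MvPolynomial (Fin n) k))).subtype) =
      perSliceSpace k n D := by
  classical
  set H := linStabilizer (∏ i : Fin n, (X i : MvPolynomial (Fin n) k)) with hH
  apply le_antisymm
  · intro x hx
    rw [Representation.mem_invariants] at hx
    have hfix : ∀ γ ∈ H, wordRep k n D γ x = x := fun γ hγ => hx ⟨γ, hγ⟩
    -- relabelling invariance, from the permutation matrices
    have hrel : ∀ (σ : Equiv.Perm (Fin n)) (u : Word n D), x (⇑σ ∘ u) = x u := by
      intro σ u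
      obtain ⟨γ, hγ⟩ : ∃ γ : GL (Fin n) k, (γ : Matrix (Fin n) (Fin n) k) = σ.permMatrix k :=
        ⟨permToGL k n σ⁻¹, by rw [permToGL, MonoidHom.coe_toHomUnits, Matrix.permMatrixHom_apply,
          inv_inv]⟩
      have hmem : γ ∈ H := mem_linStabilizer_prodX_of_coe_eq γ σ (fun _ => 1) (by simp)
        (by rw [hγ, Matrix.diagonal_one, mul_one])
      have h := congr_fun (hfix γ hmem) u
      rwa [wordRep_apply_of_coe_eq_permMatrix hγ] at h
    -- constant content on the support, from the unimodular diagonal matrices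
    have hcont : ∀ u : Word n D, x u ≠ 0 → ∀ i j : Fin n, wordContent u i = wordContent u j := by
      intro u hu i j
      by_cases hij : i = j
      · rw [hij]
      let d : Fin n → k := fun l => (if l = i then (2 : k) else 1) * (if l = j then (2⁻¹ : k) else 1)
      have hd1 : ∏ l, d l = 1 := by
        change ∏ l, (if l = i then (2 : k) else 1) * (if l = j then (2⁻¹ : k) else 1) = 1
        rw [Finset.prod_mul_distrib, Finset.prod_ite_eq' Finset.univ i, Finset.prod_ite_eq' Finset.univ j,
          if_pos (Finset.mem_univ _), if_pos (Finset.mem_univ _), mul_inv_cancel₀ (two_ne_zero : (2 : k) ≠ 0)]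
      have hdet : (Matrix.diagonal d).det ≠ 0 := by rw [Matrix.det_diagonal, hd1]; exact one_ne_zero
      set γ := Matrix.GeneralLinearGroup.mkOfDetNeZero _ hdet with hγ
      have hγc : (γ : Matrix (Fin n) (Fin n) k) = Matrix.diagonal d :=
        Matrix.GeneralLinearGroup.val_mkOfDetNeZero _ _
      have hmem : γ ∈ H := mem_linStabilizer_prodX_of_coe_eq γ 1 d hd1
        (by rw [hγc, Matrix.permMatrix_one, one_mul])
      have h := congr_fun (hfix γ hmem) u
      rw [wordRep_apply_of_coe_eq_diagonal hγc] at h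
      have hprod : (∏ p, d (u p)) = (2 : k) ^ wordContent u i * (2⁻¹ : k) ^ wordContent u j := by
        change ∏ p, (if u p = i then (2 : k) else 1) * (if u p = j then (2⁻¹ : k) else 1) = _
        rw [Finset.prod_mul_distrib, prod_eq_prod_pow_wordContent (fun l => if l = i then (2 : k) else 1),
          prod_eq_prod_pow_wordContent (fun l => if l = j then (2⁻¹ : k) else 1)]
        congr 1
        · rw [Finset.prod_eq_single i (fun l _ hl => by rw [if_neg hl, one_pow])
            (fun h => absurd (Finset.mem_univ i) h), if_pos rfl]
        · rw [Finset.prod_eq_single j (fun l _ hl => by rw [if_neg hl, one_pow])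
            (fun h => absurd (Finset.mem_univ j) h), if_pos rfl]
      have hone : (2 : k) ^ wordContent u i * (2⁻¹ : k) ^ wordContent u j = 1 :=
        mul_right_cancel₀ hu (by rw [← hprod, h, one_mul])
      exact eq_of_two_pow_mul_inv_two_pow_eq_one' hone
    refine ⟨fun u ⟨i, j, hij⟩ => ?_, hrel⟩
    by_contra h0
    exact hij (hcont u h0 i j)
  · intro x hx
    rw [Representation.mem_invariants]
    rintro ⟨γ, hγ⟩
    change wordRep k n D γ x = x
    rw [hH, linStabilizer_prodX_eq_closure] at hγ
    induction hγ using Subgroup.closure_induction with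
    | mem γ hγ =>
      rcases hγ with ⟨π, hπ⟩ | ⟨d, hd, hd1⟩
      · funext w
        rw [wordRep_apply_of_coe_eq_permMatrix hπ]
        exact hx.2 π w
      · funext w
        rw [wordRep_apply_of_coe_eq_diagonal hd]
        by_cases h0 : x w = 0
        · rw [h0, mul_zero]
        · have hw : ∀ i j : Fin n, wordContent w i = wordContent w j := by
            intro i j
            by_contra hne
            exact h0 (hx.1 w ⟨i, j, hne⟩)
          rw [prod_apply_eq_one_of_wordContent_const hd1 hw, one_mul]
    | one => rw [map_one]; rfl
    | mul γ γ' _ _ h h' => rw [map_mul, Module.End.mul_apply, h', h]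
    | inv γ _ h =>
      have h2 := congrArg (wordRep k n D γ⁻¹) h
      rw [← Module.End.mul_apply, ← map_mul, inv_mul_cancel, map_one, Module.End.one_apply] at h2
      exact h2.symm

end Words

/-! ### §1 The `𝔖_n`-invariants of the zero weight space are the invariants of `stab(x₁⋯x_n)` -/

section ZeroWeight

variable {n δ : ℕ}

/-- The scalar matrix `c · 1` acts on `(ℂ^σ)^{⊗D}` by `c^D` (Fulton–Harris §15.5; private copy of the
helper of `BLMW11DegreeDivisibilityProofs.lean`). [folklore] -/
private theorem glTensorRep_scalar_eq_pow_smul' {σ : Type} [Fintype σ] [DecidableEq σ] {D : ℕ}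
    {c : ℂ} (hc : c ≠ 0) (x : TensorPower ℂ D (σ → ℂ)) :
    glTensorRep σ ℂ D (Matrix.GeneralLinearGroup.scalar σ (Units.mk0 c hc)) x = (c ^ D) • x := by
  induction x using PiTensorProduct.induction_on with
  | smul_tprod r v =>
    rw [map_smul, glTensorRep_tprod, Matrix.GeneralLinearGroup.coe_scalar, Units.val_mk0]
    have h : (fun i => (Matrix.scalar σ c).mulVec (v i)) = fun i => c • v i := by
      funext i
      rw [Matrix.scalar_apply, ← Matrix.smul_one_eq_diagonal, Matrix.smul_mulVec, Matrix.one_mulVec]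
    rw [h, MultilinearMap.map_smul_univ, Finset.prod_const, Finset.card_univ, Fintype.card_fin,
      smul_comm]
  | add x y hx hy => rw [map_add, hx, hy, smul_add]

/-- The permutation matrices lie in the stabilizer of `x₁⋯x_n` (Bürgisser–Ikenmeyer 2017,
Prop. 2.4 (1)); here for the tree's `permToGL` (`𝔖_n → GL_n`, BLMW §8.4). [cite: BurgisserIkenmeyer2017, Prop. 2.4(1)] -/
theorem permToGL_mem_linStabilizer_prodX (w : Equiv.Perm (Fin n)) :
    permToGL ℂ n w ∈ linStabilizer (∏ i : Fin n, (X i : MvPolynomial (Fin n) ℂ)) :=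
  mem_linStabilizer_prodX_of_coe_eq _ w⁻¹ (fun _ => 1) (by simp)
    (by rw [permToGL, MonoidHom.coe_toHomUnits, Matrix.permMatrixHom_apply, Matrix.diagonal_one,
      mul_one])

/-- **The `𝔖_n`-invariants of the zero weight space `(S_μℂⁿ)_0` are the invariants of the stabilizer
of `x₁⋯x_n`** (`= T' ⋊ 𝔖_n`, `T'` the unimodular diagonal matrices; BLMW §5.5 writes this space
`(S_μE)_0^{𝔚_E}`, §8.4 "the space of `𝔖_n`-invariants in the zero weight space"): a vector of
`S_μV ⊂ V^{⊗nδ}` fixed by `T'` has `GL_n`-weight `(δ, …, δ)` — a diagonal `t` is `c · t'` with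
`cⁿ = det t`, `t' ∈ T'`, and `c · 1` acts by `c^{nδ} = (det t)^δ` — and conversely a vector of weight
`(δ, …, δ)` is fixed by `T'` (`∏ c_i^δ = 1`). [cite: BurgisserEtAl2011, §8.4 Cor. 8.4.2] -/
theorem zeroWeightInvariants_eq_subgroupInvariants (μ : Nat.Partition (n * δ)) :
    zeroWeightInvariants ℂ (n := n) μ δ =
      subgroupInvariants (V := schurModule ℂ (Fin n → ℂ) μ) (schurRep (stdRep (Fin n) ℂ) μ)
        (linStabilizer (∏ i : Fin n, (X i : MvPolynomial (Fin n) ℂ))) := by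
  classical
  set H := linStabilizer (∏ i : Fin n, (X i : MvPolynomial (Fin n) ℂ)) with hH
  set ρ := schurRep (stdRep (Fin n) ℂ) μ with hρ
  apply le_antisymm
  · intro v hv
    obtain ⟨hwt, hperm⟩ := Submodule.mem_inf.mp hv
    have hperm' : ∀ w : Equiv.Perm (Fin n), ρ (permToGL ℂ n w) v = v := fun w => by
      have h := (Submodule.mem_iInf _).mp hperm w
      rw [LinearMap.mem_eqLocus] at h
      exact h
    rw [mem_subgroupInvariants_iff]
    intro γ hγ
    rw [hH, linStabilizer_prodX_eq_closure] at hγ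
    induction hγ using Subgroup.closure_induction with
    | mem γ hγ =>
      rcases hγ with ⟨π, hπ⟩ | ⟨d, hd, hd1⟩
      · have hγeq : γ = permToGL ℂ n π⁻¹ := by
          apply Units.ext
          rw [hπ, permToGL, MonoidHom.coe_toHomUnits, Matrix.permMatrixHom_apply, inv_inv]
        rw [hγeq]
        exact hperm' π⁻¹
      · have hdiag : IsDiagonalGL γ :=
          (isDiagonalGL_iff_isDiag γ).mpr (by rw [hd]; exact Matrix.isDiag_diagonal d)
        have h := (mem_weightSpace_iff _ _ _).mp hwt γ hdiag
        have hchar : weightChar (fun _ : Fin n => (δ : ℤ)) γ = 1 := by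
          unfold weightChar
          simp_rw [hd, Matrix.diagonal_apply_eq, zpow_natCast]
          rw [Finset.prod_pow, hd1, one_pow]
        rw [h, hchar, one_smul]
    | one => rw [map_one]; rfl
    | mul γ γ' _ _ h h' => rw [map_mul, Module.End.mul_apply, h', h]
    | inv γ _ h =>
      have h2 := congrArg (ρ γ⁻¹) h
      rw [← Module.End.mul_apply, ← map_mul, inv_mul_cancel, map_one, Module.End.one_apply] at h2
      exact h2.symm
  · intro v hv
    have hfix : ∀ γ ∈ H, ρ γ v = v := fun γ hγ => (mem_subgroupInvariants_iff.mp hv) γ hγ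
    refine Submodule.mem_inf.mpr ⟨?_, ?_⟩
    · rw [zeroWeightSpace, mem_weightSpace_iff]
      intro t ht
      rcases Nat.eq_zero_or_pos n with hn0 | hnpos
      · subst hn0
        have h1 : t = 1 := Subsingleton.elim _ _
        subst h1
        rw [map_one, weightChar_one, one_smul]
        rfl
      · set P : ℂ := ∏ i, (t : Matrix (Fin n) (Fin n) ℂ) i i with hP
        have hP0 : P ≠ 0 :=
          Finset.prod_ne_zero_iff.mpr fun i _ => diag_ne_zero_of_isUpperTriangular ht.1 i
        obtain ⟨c, hc⟩ := IsAlgClosed.exists_pow_nat_eq P hnpos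
        have hc0 : c ≠ 0 := by
          rintro rfl
          rw [zero_pow hnpos.ne'] at hc
          exact hP0 hc.symm
        set s : GL (Fin n) ℂ := Matrix.GeneralLinearGroup.scalar (Fin n) (Units.mk0 c hc0) with hs
        have hsinv : ((s⁻¹ : GL (Fin n) ℂ) : Matrix (Fin n) (Fin n) ℂ) = Matrix.diagonal fun _ => c⁻¹ := by
          rw [hs, ← map_inv, Matrix.GeneralLinearGroup.coe_scalar, Units.val_inv_eq_inv_val,
            Units.val_mk0, Matrix.scalar_apply]
        have hcoe : (((s⁻¹ * t : GL (Fin n) ℂ)) : Matrix (Fin n) (Fin n) ℂ) =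
            Matrix.diagonal fun i => c⁻¹ * (t : Matrix (Fin n) (Fin n) ℂ) i i := by
          rw [Units.val_mul, hsinv]
          conv_lhs => rw [coe_eq_diagonal_of_isDiagonalGL ht, Matrix.diagonal_mul_diagonal]
        have hprod : ∏ i, c⁻¹ * (t : Matrix (Fin n) (Fin n) ℂ) i i = 1 := by
          rw [Finset.prod_mul_distrib, Finset.prod_const, Finset.card_univ, Fintype.card_fin, ← hP,
            ← hc, inv_pow, inv_mul_cancel₀ (pow_ne_zero _ hc0)]
        have hmem : s⁻¹ * t ∈ H :=
          mem_linStabilizer_prodX_of_coe_eq _ 1 _ hprod (by rw [hcoe, Matrix.permMatrix_one, one_mul])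
        have key : ρ t v = ρ s (ρ (s⁻¹ * t) v) := by
          rw [← Module.End.mul_apply, ← map_mul, mul_inv_cancel_left]
        have hscal : ρ s v = (c ^ (n * δ)) • v := by
          apply Subtype.ext
          rw [hρ, coe_schurRep_apply, tensorDiagRep_stdRep, Submodule.coe_smul]
          exact glTensorRep_scalar_eq_pow_smul' hc0 _
        rw [key, hfix _ hmem, hscal]
        congr 1
        unfold weightChar
        simp_rw [zpow_natCast]
        rw [Finset.prod_pow, ← hP, ← hc, ← pow_mul]
    · refine (Submodule.mem_iInf _).mpr fun w => ?_
      rw [LinearMap.mem_eqLocus]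
      exact hfix _ (permToGL_mem_linStabilizer_prodX w)

end ZeroWeight

/-! ### §3 `D! · dim (S_μℂⁿ)_0^{𝔖_n} = ∑_τ χ^μ(τ) χ₀(τ)` -/

section Count

open IK2020

/-- `reindexGL` along the identity is the identity. [folklore] -/
private theorem reindexGL_refl' {N : ℕ} (g : GL (Fin N) ℂ) : reindexGL (OrderIso.refl (Fin N)) g = g := by
  apply Units.ext
  rw [coe_reindexGL]
  rfl

/-- Pulling back a subgroup along `reindexGL (OrderIso.refl)` does nothing. [folklore] -/
private theorem comap_reindexGL_refl {N : ℕ} (H : Subgroup (GL (Fin N) ℂ)) :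
    H.comap (reindexGL (k := ℂ) (OrderIso.refl (Fin N))) = H := by
  ext g
  rw [Subgroup.mem_comap, reindexGL_refl']

/-- **`D! · dim (S_μℂⁿ)_0^{𝔖_n} = ∑_{τ ∈ 𝔖_D} χ^μ(τ) χ₀(τ)`** (`D = nδ`, `μ ⊢ D` with at most `n` parts,
`χ₀` the character of `𝔖_D` on `perSliceSpace ℂ n D`): the dimension of BLMW's `(S_μE)_0^{𝔚_E}`
(Cor. 8.4.2, left side) is the multiplicity `⟨χ^μ, χ₀⟩` of `[μ]` in the `𝔖_D`-module
`((E^{⊗D})_0)^{𝔚_E} ≅ ℂ[𝔖_D/𝔖_n ≀ 𝔖_δ]`. Chain: §1, the transport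
`finrank_subgroupInvariants_schurRep_stdRep_eq_weylInvariantDim`, Ikenmeyer–Kandasamy's
`dim {μ}^H = dim T_H` (`finrank_boundSpace_invariants_eq_weylInvariantDim`), §2, and
`card_mul_finrank_boundSpace` with `character_transposedPermRep_dualOfPartition` (Schur–Weyl:
the transposed weight space of `μ^*` carries `χ^μ`). [cite: BurgisserEtAl2011, §8.4 Cor. 8.4.2] -/
theorem factorial_mul_finrank_zeroWeightInvariants {n δ : ℕ} (μ : Nat.Partition (n * δ))
    (hμ : μ.parts.card ≤ n) :
    (((n * δ).factorial : ℕ) : ℂ) * (Module.finrank ℂ (zeroWeightInvariants ℂ (n := n) μ δ) : ℂ) =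
      ∑ τ : Equiv.Perm (Fin (n * δ)), spechtCharacter ℂ μ τ *
        ((wordPermRep ℂ n (n * δ)).subrepresentation (perSliceSpace ℂ n (n * δ))
          (perSliceSpace_le_comap ℂ)).character τ := by
  classical
  rw [zeroWeightInvariants_eq_subgroupInvariants μ,
    finrank_subgroupInvariants_schurRep_stdRep_eq_weylInvariantDim (OrderIso.refl (Fin n)),
    comap_reindexGL_refl, ← finrank_boundSpace_invariants_eq_weylInvariantDim ℂ _ μ hμ,
    invariants_wordRep_prodXStabilizer_eq_perSliceSpace]
  have h := card_mul_finrank_boundSpace ℂ (Weight.dualOfPartition n μ) (perSliceSpace ℂ n (n * δ))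
    (perSliceSpace_le_comap ℂ)
  rw [Fintype.card_perm, Fintype.card_fin, character_transposedPermRep_dualOfPartition ℂ μ hμ] at h
  exact h

end Count

/-! ### §4 Character orthogonality on `𝔖_D` and the degenerate alphabet `n = 0` -/

section Orthogonality

variable {D : ℕ}

/-- **Row orthogonality of the Specht characters**: `∑_{τ ∈ 𝔖_D} χ^μ(τ) χ^ν(τ) = [μ = ν] · D!`
(Serre §2.3 Thm. 3 for the irreducible characters `χ^μ` of `𝔖_D`, which are real:
`χ^ν(τ⁻¹) = χ^ν(τ)`). [cite: FultonHarrisGTM129, §2.2 (2.10) and Thm. 4.3] -/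
theorem sum_spechtCharacter_mul_spechtCharacter (μ ν : Nat.Partition D) :
    ∑ τ : Equiv.Perm (Fin D), spechtCharacter ℂ μ τ * spechtCharacter ℂ ν τ =
      if μ = ν then ((D.factorial : ℕ) : ℂ) else 0 := by
  classical
  have h := IsIrrChar.classInner_eq (isIrrChar_spechtCharacter μ) (isIrrChar_spechtCharacter ν)
  rw [classInner_apply, Fintype.card_perm, Fintype.card_fin] at h
  simp_rw [RepresentationTheory.FiniteGroups.spechtCharacter_inv] at h
  have hD : ((D.factorial : ℕ) : ℂ) ≠ 0 := Nat.cast_ne_zero.mpr (Nat.factorial_ne_zero D)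
  have h' := congrArg (fun z => ((D.factorial : ℕ) : ℂ) * z) h
  simp only [← mul_assoc, mul_inv_cancel₀ hD, one_mul] at h'
  rw [h']
  by_cases hμν : μ = ν
  · rw [if_pos hμν, if_pos (by rw [hμν]), mul_one]
  · rw [if_neg hμν, if_neg (fun h => hμν (spechtCharacter_injective h)), mul_zero]

/-- **Fourier coefficients from a pointwise expansion**: if a function `χ₀` on `𝔖_D` is the
combination `∑_{ν ∈ S} c_ν χ^ν` of Specht characters, then `∑_τ χ^μ(τ) χ₀(τ) = D! · c_μ` for `μ ∈ S`
and `0` for `μ ∉ S` (row orthogonality). [cite: FultonHarrisGTM129, §2.2 (2.10)] -/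
theorem sum_spechtCharacter_mul_eq_of_eq_sum {χ₀ : Equiv.Perm (Fin D) → ℂ}
    (S : Finset (Nat.Partition D)) (c : Nat.Partition D → ℂ)
    (h : ∀ τ, χ₀ τ = ∑ ν ∈ S, c ν * spechtCharacter ℂ ν τ) (μ : Nat.Partition D) :
    ∑ τ : Equiv.Perm (Fin D), spechtCharacter ℂ μ τ * χ₀ τ =
      if μ ∈ S then ((D.factorial : ℕ) : ℂ) * c μ else 0 := by
  classical
  simp_rw [h, Finset.mul_sum]
  rw [Finset.sum_comm]
  have hterm : ∀ ν ∈ S, ∑ τ : Equiv.Perm (Fin D), spechtCharacter ℂ μ τ * (c ν * spechtCharacter ℂ ν τ) =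
      if μ = ν then ((D.factorial : ℕ) : ℂ) * c ν else 0 := by
    intro ν _
    have : ∑ τ : Equiv.Perm (Fin D), spechtCharacter ℂ μ τ * (c ν * spechtCharacter ℂ ν τ) =
        c ν * ∑ τ : Equiv.Perm (Fin D), spechtCharacter ℂ μ τ * spechtCharacter ℂ ν τ := by
      rw [Finset.mul_sum]
      exact Finset.sum_congr rfl fun τ _ => by ring
    rw [this, sum_spechtCharacter_mul_spechtCharacter]
    split_ifs <;> ring
  rw [Finset.sum_congr rfl hterm, Finset.sum_ite_eq S μ]

end Orthogonality

section AlphabetZero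

/-- With no letters and positive inner degree there are no coordinates on `Sym^δ(k^0) = 0`: the
index type `DegIdx (Fin 0) δ` of monomials of degree `δ > 0` in `0` variables is empty. [folklore] -/
private theorem isEmpty_degIdx_fin_zero {δ : ℕ} (hδ : 0 < δ) : IsEmpty (DegIdx (Fin 0) δ) := by
  refine ⟨fun d => ?_⟩
  have hd := mem_degMonomials_iff.mp d.2
  have h0 : (d.1 : Fin 0 →₀ ℕ) = 0 := Subsingleton.elim _ _
  rw [h0, map_zero] at hd
  omega

/-- **The plethysm coefficient over the zero space is `1`** (`δ > 0`): `k[Sym^δ (k^0)] = k` with the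
trivial action of the trivial group `GL_0`, so every weight has a one-dimensional highest-weight
space. (The degenerate alphabet `n = 0` of Cor. 8.4.2: `S_∅(ℂ^0) = ℂ = S^0(S^δ ℂ^0)`.) [folklore] -/
private theorem plethysmCoeffOfPartition_alphabet_zero {δ : ℕ} (hδ : 0 < δ) (μ : Nat.Partition (0 * δ)) :
    plethysmCoeffOfPartition ℂ 0 δ μ = 1 := by
  haveI : IsEmpty (DegIdx (Fin 0) δ) := isEmpty_degIdx_fin_zero hδ
  unfold plethysmCoeffOfPartition plethysmCoeff hwMultiplicity
  have htop : highestWeightSpace (coordRep (Fin 0) ℂ δ) (Weight.dualOfPartition 0 μ) = ⊤ := by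
    rw [eq_top_iff]
    intro F _ g _
    have hg : g = 1 := Subsingleton.elim _ _
    subst hg
    rw [map_one, weightChar_one, one_smul]
    rfl
  rw [htop, finrank_top, (MvPolynomial.isEmptyAlgEquiv ℂ (DegIdx (Fin 0) δ)).toLinearEquiv.finrank_eq,
    Module.finrank_self]

/-- For `n = 0` letters (and `δ > 0`) the slice space is everything: there is exactly one word (the
empty one, `D = 0·δ = 0`) and both defining conditions are vacuous. [folklore] -/
private theorem perSliceSpace_alphabet_zero_eq_top {δ : ℕ} : perSliceSpace ℂ 0 (0 * δ) = ⊤ := by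
  rw [eq_top_iff]
  intro y _
  refine ⟨fun u ⟨i, _, _⟩ => i.elim0, fun σ u => ?_⟩
  have hσ : σ = 1 := Subsingleton.elim _ _
  subst hσ
  rfl

/-- **Cor. 8.4.2 in the degenerate alphabet `n = 0`** (`δ > 0`, `μ = ∅ ⊢ 0`): both sides are `1`
(`(S_∅ℂ^0)_0^{𝔖_0} = ℂ`; one empty word; `χ^∅(1) = f^∅ = 1`). [cite: BurgisserEtAl2011, §8.4 Cor. 8.4.2] -/
theorem finrank_zeroWeightInvariants_alphabet_zero {δ : ℕ} (hδ : 0 < δ) (μ : Nat.Partition (0 * δ))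
    (hμ : μ.parts.card ≤ 0) :
    Module.finrank ℂ (zeroWeightInvariants ℂ (n := 0) μ δ) = plethysmCoeffOfPartition ℂ 0 δ μ := by
  classical
  rw [plethysmCoeffOfPartition_alphabet_zero hδ]
  have h := factorial_mul_finrank_zeroWeightInvariants μ hμ
  have hf : (0 * δ).factorial = 1 := by simp
  haveI : IsEmpty (Fin (0 * δ)) := ⟨fun i => by have := i.2; omega⟩
  rw [hf, Nat.cast_one, one_mul, Fintype.sum_unique] at h
  have h1 : (default : Equiv.Perm (Fin (0 * δ))) = 1 := Subsingleton.elim _ _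
  rw [h1] at h
  -- `χ^μ(1) = f^μ = 1`
  have hchar : spechtCharacter ℂ μ 1 = 1 := by
    rw [show spechtCharacter ℂ μ 1 = (Module.finrank ℂ (spechtIdeal ℂ μ) : ℂ) from
      Representation.char_one _, finrank_spechtIdeal_holds ℂ μ]
    have hdvd := numStandardTableaux_dvd_factorial μ
    rw [hf, Nat.dvd_one] at hdvd
    rw [hdvd, Nat.cast_one]
  -- `χ₀(1) = dim perSliceSpace = 1`
  have hχ0 : ((wordPermRep ℂ 0 (0 * δ)).subrepresentation (perSliceSpace ℂ 0 (0 * δ))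
      (perSliceSpace_le_comap ℂ)).character 1 = 1 := by
    rw [Representation.char_one]
    have hdim : Module.finrank ℂ ↥(perSliceSpace ℂ 0 (0 * δ)) = 1 := by
      rw [perSliceSpace_alphabet_zero_eq_top, finrank_top, Module.finrank_fintype_fun_eq_card,
        Fintype.card_fun, Fintype.card_fin, Fintype.card_fin]
      simp
    rw [hdim, Nat.cast_one]
  rw [hchar, hχ0, mul_one] at h
  exact_mod_cast h

end AlphabetZero

/-! ### §5 Assembly: Cor. 8.4.2 from the character identity on `perSliceSpace` -/

section Assembly

/-- **BLMW 2011, Cor. 8.4.2 from the `𝔖_D`-character identity of `perSliceSpace`**: if for all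
`n ≥ 1`, `δ ≥ 1` and `μ ⊢ nδ` with at most `n` parts
`∑_{τ ∈ 𝔖_{nδ}} χ^μ(τ) χ₀(τ) = (nδ)! · p_μ` (`χ₀` the character of `perSliceSpace ℂ n (nδ)`,
`p_μ = plethysmCoeffOfPartition ℂ n δ μ` — Gay's theorem in character form: the multiplicity of `[μ]`
in `((ℂⁿ)^{⊗nδ})_0^{𝔖_n} ≅ ℂ[𝔖_{nδ}/𝔖_n ≀ 𝔖_δ]` is the plethysm coefficient), then the named fact
`BLMW2011_cor_8_4_2` holds (`factorial_mul_finrank_zeroWeightInvariants`; the alphabet `n = 0` is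
`finrank_zeroWeightInvariants_alphabet_zero`). [cite: BurgisserEtAl2011, §8.4 Cor. 8.4.2] -/
theorem BLMW2011_cor_8_4_2_of_characterIdentity
    (h : ∀ (n δ : ℕ) (μ : Nat.Partition (n * δ)), 0 < n → 0 < δ → μ.parts.card ≤ n →
      ∑ τ : Equiv.Perm (Fin (n * δ)), spechtCharacter ℂ μ τ *
          ((wordPermRep ℂ n (n * δ)).subrepresentation (perSliceSpace ℂ n (n * δ))
            (perSliceSpace_le_comap ℂ)).character τ =
        (((n * δ).factorial : ℕ) : ℂ) * (plethysmCoeffOfPartition ℂ n δ μ : ℂ)) :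
    BLMW2011_cor_8_4_2 := by
  intro n δ μ hδ hμ
  rcases Nat.eq_zero_or_pos n with hn0 | hn
  · subst hn0
    exact finrank_zeroWeightInvariants_alphabet_zero hδ μ hμ
  · have h1 := factorial_mul_finrank_zeroWeightInvariants μ hμ
    rw [h n δ μ hn hδ hμ] at h1
    have hD : (((n * δ).factorial : ℕ) : ℂ) ≠ 0 := Nat.cast_ne_zero.mpr (Nat.factorial_ne_zero _)
    exact_mod_cast mul_left_cancel₀ hD h1

end Assembly

/-! ### §6 The discharge of `BLMW2011_cor_8_4_2` -/

section Discharge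

/-- **BLMW 2011, Cor. 8.4.2 (Gay 1976), discharged**: "Let `μ` be a partition of size `nδ`. The
dimension of the space of `𝔖_n`-invariants in the zero weight space `(S_μℂⁿ)_0` equals the
multiplicity of `S_μℂⁿ` in the plethysm `S^n(S^δℂⁿ)`" — as typed (`δ > 0`, `ℓ(μ) ≤ n`):
`dim (S_μℂⁿ)_0^{𝔖_n} = plethysmCoeffOfPartition ℂ n δ μ`. Proof: §5
(`BLMW2011_cor_8_4_2_of_characterIdentity`: `(nδ)! · dim = ∑_τ χ^μ(τ) χ₀(τ)` through the
`H`-invariants of `S_μℂⁿ`, `H = Stab(x₁⋯x_n)`, and the alphabet `n = 0`) with the character identity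
`∑_τ χ^μ(τ) χ₀(τ) = (nδ)! · p_μ` of `BLMW11PerSliceCharacterProofs.lean`
(`sum_spechtCharacter_mul_character_perSliceSpace`, val-lit t08: the multiplicity of `[μ]` in
`perSliceSpace ≅ ℂ[𝔖_{nδ}/𝔖_n ≀ 𝔖_δ]` is `p_μ = dim HW_μ^{𝔖_n ≀ 𝔖_δ}`).
[cite: BurgisserEtAl2011, §8.4 Cor. 8.4.2] -/
theorem BLMW2011_cor_8_4_2_holds : BLMW2011_cor_8_4_2 :=
  BLMW2011_cor_8_4_2_of_characterIdentity fun n _δ μ hn hδ hμ => by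
    haveI : NeZero n := ⟨hn.ne'⟩
    exact sum_spechtCharacter_mul_character_perSliceSpace ℂ hδ μ hμ

end Discharge

end Literature.Computability.AlgebraicComplexity
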